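import Summits.RiemannHypothesis.RiemannHypothesis.Theses.WeilComb
import Summits.RiemannHypothesis.RiemannHypothesis.Theorems.WeilCombCombShapePositivityArchOffdiagBounds
import Literature.NumberTheory.LFunctions.WeilExplicit
import Literature.NumberTheory.LFunctions.WeilMellinBounds
import Literature.NumberTheory.LFunctions.WeilArchimedeanMoments
import Mathlib.NumberTheory.Harmonic.Bounds
import Mathlib.Analysis.InnerProductSpace.Basic

/-!
# STUB-IDEAS `stub_windowCore` (k = 2, RESHAPE) — typed helper lemmas (elaboration sanity only; all `sorry`)

Perron-pivot Schur complement on the top cells: `a = β u + y`, `u_m = m^{-1/2}`, `y ⊥ u`.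
-/

noncomputable section

set_option linter.dupNamespace false

open scoped BigOperators ComplexConjugate InnerProductSpace
open Complex MeasureTheory

namespace Summit.RiemannHypothesis.RiemannHypothesis.Cruxes.CombShapePositivity.StubIdeasWindowCore2

open Literature.NumberTheory.LFunctions

/-- the fixed bump `φ₀` as a complex test function -/
def phi0 : ℝ → ℂ := fun u : ℝ => ((expNegInvGlue (1 - u ^ 2) : ℝ) : ℂ)
/-- `φ_ε(t) = ε⁻¹ φ₀(t/ε)` -/
def phiE (ε : ℝ) : ℝ → ℂ := fun t : ℝ => (ε : ℂ)⁻¹ * ((expNegInvGlue (1 - (t / ε) ^ 2) : ℝ) : ℂ)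
/-- `ψ_ε = φ_ε ⋆ φ̃_ε` -/
def psiE (ε : ℝ) : ℝ → ℂ := weilConv (phiE ε) (weilReflect (phiE ε))
/-- the comb `g_a = Σ_{m ≤ M} a_m φ_ε(· − log m)` (verbatim shape of the crux) -/
def comb (ε : ℝ) (M : ℕ) (a : ℕ → ℂ) : ℝ → ℂ := fun x : ℝ => ∑ m ∈ Finset.Icc 1 M,
  a m * ((ε : ℂ)⁻¹ * ((expNegInvGlue (1 - ((x - Real.log (m : ℝ)) / ε) ^ 2) : ℝ) : ℂ))
/-- the Perron ray `u_m = m^{-1/2}` -/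
def perron : ℕ → ℂ := fun k : ℕ => ((Real.sqrt (k : ℝ) : ℝ) : ℂ)⁻¹
/-- `I₀ = ∫ φ₀`, `N = ‖φ₀‖₂²`, `U = ε⁻¹ N` -/
def I0 : ℝ := ∫ u : ℝ, expNegInvGlue (1 - u ^ 2)
def N0 : ℝ := weilNorm2Sq phi0
/-- Dirichlet energy `D(a) = Σ_m Σ_{n ≤ M/m} Λ(n) ‖a(nm) − n^{-1/2} a(m)‖²` -/
def dirichletEnergy (M : ℕ) (a : ℕ → ℂ) : ℝ :=
  ∑ m ∈ Finset.Icc 1 M, ∑ n ∈ Finset.Icc 1 (M / m),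
    (ArithmeticFunction.vonMangoldt n : ℝ) * ‖a (n * m) - ((Real.sqrt n : ℂ))⁻¹ * a m‖ ^ 2
/-- Bombieri's off-diagonal kernel `g(t) = e^{t/2}/(2 sinh t)` -/
def gker (t : ℝ) : ℝ := Real.exp (t / 2) / (2 * Real.sinh t)

/-! ## HL1 — kernel averaging (window-uniform replacement of the point-mass bound `g(|x| − 2ε)`) -/

/-- HL1a: chord of the convex map `s ↦ 1/(1 − s w)` on `[0,1]`. -/
theorem inv_chord (w s : ℝ) (hw0 : 0 ≤ w) (hw1 : w < 1) (hs0 : 0 ≤ s) (hs1 : s ≤ 1) :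
    1 / (1 - s * w) ≤ (1 - s) + s / (1 - w) := by
  sorry

/-- HL1b: for an even density `p ≥ 0` on `[−2ε, 2ε]` and `x > 2ε`, with `θ = 2ε/x` and
`C·∫p ≥ ∫ p(v)/(1 − (v/2ε)²)`:  `∫ p(v)/(2(x+v)) ≤ (1/2x)(1 + θ²(C − 1)) ∫ p`
(symmetrise `v ↦ −v`, then HL1a pointwise with `w = (v/2ε)²`, `s = θ²`). -/
theorem kernelAvg_singular_le (ε x C : ℝ) (p : ℝ → ℝ) (hε : 0 < ε) (hx : 2 * ε < x)
    (hp : ∀ v, 0 ≤ p v) (heven : ∀ v, p (-v) = p v) (hsupp : ∀ v, 2 * ε ≤ |v| → p v = 0)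
    (hint : IntervalIntegrable p volume (-(2 * ε)) (2 * ε))
    (hCint : IntervalIntegrable (fun v => p v / (1 - (v / (2 * ε)) ^ 2)) volume (-(2 * ε)) (2 * ε))
    (hC : ∫ v in (-(2 * ε))..(2 * ε), p v / (1 - (v / (2 * ε)) ^ 2) ≤
      C * ∫ v in (-(2 * ε))..(2 * ε), p v) :
    ∫ v in (-(2 * ε))..(2 * ε), p v / (2 * (x + v)) ≤
      1 / (2 * x) * (1 + (2 * ε / x) ^ 2 * (C - 1)) * ∫ v in (-(2 * ε))..(2 * ε), p v := by
  sorry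

/-- HL1c: the regular part of Bombieri's kernel: `g(t) ≤ 1/(2t) + 1/4` and `g` is convex on `(0, ∞)`
(`g(t) = 1/(2t) + 1/4 − t/48 + O(t³)`). -/
theorem gker_le (t : ℝ) (ht : 0 < t) : gker t ≤ 1 / (2 * t) + 1 / 4 := by
  sorry

theorem gker_convex : ConvexOn ℝ (Set.Ioi (0 : ℝ)) gker := by
  sorry

/-! ## HL2 — window-uniform two-sided entry bounds (sharpen p111xxx `weilArchTerm_translate_psi_offdiag_bounds`) -/

/-- HL2: for `x > 2ε`: `−I₀²( g(x) + (C−1)(2ε/x)²/(2x) + ε ) ≤ Re W_∞(τ_x ψ_ε) ≤ −I₀² g(x)`;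
upper = Jensen (`g` convex, `ψ_ε` even of mass `I₀²`), lower = HL1b on `1/(2t)` + Lipschitz `|h'| ≤ 1/2` on
`h = g − 1/(2t)`; `C` = the bump constant `C_T = I₀⁻² ∫ ψ₀(v)/(1 − v²/4) dv` (≈ 1.1; any certified `C ≤ 2` is fine). -/
theorem arch_entry_bounds_window (C : ℝ)
    (hC : ∫ v : ℝ, (weilConv phi0 (weilReflect phi0) v).re / (1 - (v / 2) ^ 2) ≤ C * I0 ^ 2) :
    ∀ ε : ℝ, 0 < ε → ∀ x : ℝ, 2 * ε < x →
      -(I0 ^ 2 * (gker x + (C - 1) * (2 * ε / x) ^ 2 / (2 * x) + ε)) ≤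
          (weilArchTerm (weilTranslate (psiE ε) x)).re ∧
        (weilArchTerm (weilTranslate (psiE ε) x)).re ≤ -(I0 ^ 2 * gker x) := by
  sorry

/-! ## HL3 — the Perron row of the archimedean kernel in closed form (screening of the pole) -/

/-- HL3a: `g(log(m/m'))·m'^{-1/2} = m√m/(m² − m'²)` for `0 < m' < m` (and symmetrically). -/
theorem gker_log_ratio (m m' : ℕ) (hm' : 0 < m') (hlt : m' < m) :
    gker (Real.log m - Real.log m') * (Real.sqrt (m' : ℝ))⁻¹ =
      (m : ℝ) * Real.sqrt (m : ℝ) / ((m : ℝ) ^ 2 - (m' : ℝ) ^ 2) := by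
  sorry

/-- HL3b: the exact row sum against the Perron ray (the harmonic identity already inside `stub_offdiagSchur`, p109602):
`Σ_{m'<m} m√m/(m²−m'²) + Σ_{m<m'≤M} m'√m/(m'²−m²) = (√m/2)(H_{M−m} + H_{M+m} − 3/(2m))`. -/
theorem perron_arch_rowSum (M m : ℕ) (hm : 1 ≤ m) (hmM : m ≤ M) :
    ∑ m' ∈ Finset.Ico 1 m, (m : ℝ) * Real.sqrt (m : ℝ) / ((m : ℝ) ^ 2 - (m' : ℝ) ^ 2) +
      ∑ m' ∈ Finset.Ioc m M, (m' : ℝ) * Real.sqrt (m : ℝ) / ((m' : ℝ) ^ 2 - (m : ℝ) ^ 2) =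
      Real.sqrt (m : ℝ) / 2 * ((harmonic (M - m) : ℝ) + (harmonic (M + m) : ℝ) - 3 / (2 * (m : ℝ))) := by
  sorry

/-- HL3c (screening, leading order): the pole row `+R·ε·H_M·√m` and the archimedean row `−(R ε/2)√m(H_{M−m}+H_{M+m}−3/2m)`
against `u` cancel to the boundary-layer profile `(Rε/2)√m·s_M(m)`, `0 ≤ s_M(m) = 2H_M − H_{M−m} − H_{M+m} + 3/(2m) ≤ −log(1−(m/M)²) + 3/(2m) + 1`
(pure harmonic-number inequalities). -/
theorem screening_profile_bounds (M m : ℕ) (hm : 1 ≤ m) (hmM : m < M) :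
    0 ≤ 2 * (harmonic M : ℝ) - (harmonic (M - m) : ℝ) - (harmonic (M + m) : ℝ) + 3 / (2 * (m : ℝ)) ∧
    2 * (harmonic M : ℝ) - (harmonic (M - m) : ℝ) - (harmonic (M + m) : ℝ) ≤
      -Real.log (1 - ((m : ℝ) / M) ^ 2) + 1 / ((M : ℝ) - m) := by
  sorry

/-! ## HL4 — the 2×2 closure (pivot Schur complement; sibling of `temple_inner`) -/

variable {V : Type*} [NormedAddCommGroup V] [InnerProductSpace ℂ V]

/-- HL4: if `Re⟪Ku,u⟫ ≥ μ‖u‖²`, `|⟪Ku,h⟫|² ≤ c‖h‖²` and `Re⟪Kh,h⟫ ≥ κ‖h‖²` for `h ⊥ u`, and `c ≤ μκ‖u‖²`… here with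
`‖u‖` folded into `μ`: PSD. -/
theorem schur_pivot (K : V →ₗ[ℂ] V) (hK : ∀ x y : V, ⟪K x, y⟫_ℂ = ⟪x, K y⟫_ℂ) (u : V)
    {μ κ c : ℝ} (hμ : 0 ≤ μ) (hκ : 0 ≤ κ) (hRay : μ ≤ (⟪K u, u⟫_ℂ).re)
    (hres : ∀ h : V, ⟪u, h⟫_ℂ = 0 → ‖⟪K u, h⟫_ℂ‖ ^ 2 ≤ c * ‖h‖ ^ 2)
    (hcoer : ∀ h : V, ⟪u, h⟫_ℂ = 0 → κ * ‖h‖ ^ 2 ≤ (⟪K h, h⟫_ℂ).re)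
    (hclose : c ≤ μ * κ) (a : V) :
    0 ≤ (⟪K a, a⟫_ℂ).re := by
  sorry

/-! ## HL5 — spectral gap of the divisor-graph energy on the Perron complement (NEW tool; numerics: bottom =
2-adic parity twist of `u`, `g_⊥(M)` = 1.07 (M=12), 1.15 (40), 1.20 (120), 1.24 (480) ↑ 2 log 2) -/

/-- HL5: for `M ≥ 12` and `Σ_m y_m m^{-1/2} = 0`:  `Σ ‖y_m‖² ≤ D(y)`.
Proof route: induct on the sieving prime — exact `p`-adic fibre chains (gap `p log p/(p−1)` in the limit, `≥ 1.04`
for every finite fibre) + Jensen transfer of the fibre means to the odd divisor graph. -/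
theorem divisorGraph_gap_perp (M : ℕ) (hM : 12 ≤ M) (y : ℕ → ℂ)
    (hperp : ∑ m ∈ Finset.Icc 1 M, y m * ((Real.sqrt (m : ℝ) : ℝ) : ℂ)⁻¹ = 0) :
    ∑ m ∈ Finset.Icc 1 M, ‖y m‖ ^ 2 ≤ dirichletEnergy M y := by
  sorry

/-! ## HL6–HL8 — the three inputs of the closure on the TOP CELLS `2ε(M+1) ≤ 1 < 2ε(M+2)`, `M ≥ M₀` -/

/-- HL8 (Perron Rayleigh quotient, Λ-free + certified bump constants `R = I₀²/N`, `c_d`; target `μ̂ = 1/19 < m_∞(1/2) = 0.0555`):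
`Re Q(g_u) ≥ (1/19)·U·H_M`. -/
theorem perron_rayleigh_topCells : ∀ ε : ℝ, 0 < ε → ∀ M : ℕ, 320 ≤ M →
    2 * ε * ((M : ℝ) + 1) ≤ 1 → 1 < 2 * ε * ((M : ℝ) + 2) →
    1 / 19 * (ε⁻¹ * N0) * (∑ m ∈ Finset.Icc 1 M, (1 : ℝ) / m) ≤ (weilQuadratic (comb ε M perron)).re := by
  sorry

/-- HL7 (screened cross term; target `c_* = 1/18`, numerics 0.044–0.049): for `y ⊥ u`,
`|W(g_u ⋆ g̃_y)|² ≤ (1/18)·U²·‖y‖²`.  Route: pole row + HL3 arch row cancel (HL3c), HL2 controls the smoothing,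
prime row = `−E₁(M/m) u_m` with `E₁ = ψ₁ − log + γ` (two-sided Mertens), then Cauchy–Schwarz. -/
theorem perron_cross_topCells : ∀ ε : ℝ, 0 < ε → ∀ (M : ℕ) (y : ℕ → ℂ), 320 ≤ M →
    2 * ε * ((M : ℝ) + 1) ≤ 1 → 1 < 2 * ε * ((M : ℝ) + 2) →
    ∑ m ∈ Finset.Icc 1 M, y m * ((Real.sqrt (m : ℝ) : ℝ) : ℂ)⁻¹ = 0 →
    ‖weilFunctional (weilConv (comb ε M perron) (weilReflect (comb ε M y)))‖ ^ 2 ≤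
      1 / 18 * (ε⁻¹ * N0) ^ 2 * ∑ m ∈ Finset.Icc 1 M, ‖y m‖ ^ 2 := by
  sorry

/-- HL6 (THE HARD ONE — pole-free coercivity on the Perron complement; target `κ₀ = 1/6`, true value ≈ 0.5):
for `y ⊥ u` on a top cell, `Re Q(g_y) ≥ (1/6)·U·‖y‖²`.  On `u^⊥` the pole vanishes identically (`A₋(y) = 0`), and
`Q(g_y)/U = D(y) + Off(y)/U + Σ_m (log(1/λ) − 1.378 − E₁(M/m))‖y_m‖²`; bottom modes = small-prime twists of `u`
(`D ≈ 2 log 2`, `Off ≈ 0`), enemies = additively coherent top blocks (`D ≈ log M`, `Off ≈ −0.6 log M`). -/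
theorem perp_coercivity_topCells : ∀ ε : ℝ, 0 < ε → ∀ (M : ℕ) (y : ℕ → ℂ), 320 ≤ M →
    2 * ε * ((M : ℝ) + 1) ≤ 1 → 1 < 2 * ε * ((M : ℝ) + 2) →
    ∑ m ∈ Finset.Icc 1 M, y m * ((Real.sqrt (m : ℝ) : ℝ) : ℂ)⁻¹ = 0 →
    1 / 6 * (ε⁻¹ * N0) * ∑ m ∈ Finset.Icc 1 M, ‖y m‖ ^ 2 ≤ (weilQuadratic (comb ε M y)).re := by
  sorry

/-- HL6, fully inlined form (as a `--supports` file would state it). -/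
theorem perp_coercivity_topCells_inline : ∀ ε : ℝ, 0 < ε → ∀ (M : ℕ) (y : ℕ → ℂ), 320 ≤ M →
    2 * ε * ((M : ℝ) + 1) ≤ 1 → 1 < 2 * ε * ((M : ℝ) + 2) →
    ∑ m ∈ Finset.Icc 1 M, y m * ((Real.sqrt (m : ℝ) : ℝ) : ℂ)⁻¹ = 0 →
    1 / 6 * (ε⁻¹ * weilNorm2Sq (fun u : ℝ => ((expNegInvGlue (1 - u ^ 2) : ℝ) : ℂ))) *
        ∑ m ∈ Finset.Icc 1 M, ‖y m‖ ^ 2 ≤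
      (weilQuadratic (fun x : ℝ => ∑ m ∈ Finset.Icc 1 M,
        y m * ((ε : ℂ)⁻¹ * ((expNegInvGlue (1 - ((x - Real.log (m : ℝ)) / ε) ^ 2) : ℝ) : ℂ)))).re := by
  sorry

/-! ## Assembly sketch: top cells, `M ≥ 320`, from HL4 + HL6–HL8 (the `M < 320` top cells are certified cells) -/

/-- closure arithmetic: `c_* ≤ μ̂ κ₀ H_M` with `(1/18) ≤ (1/19)(1/6) H_M` iff `H_M ≥ 6.33…`, true for `M ≥ 320`. -/
theorem closure_constants (M : ℕ) (hM : 320 ≤ M) :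
    (1 : ℝ) / 18 ≤ 1 / 19 * (1 / 6) * ∑ m ∈ Finset.Icc 1 M, (1 : ℝ) / m := by
  sorry

end Summit.RiemannHypothesis.RiemannHypothesis.Cruxes.CombShapePositivity.StubIdeasWindowCore2

end
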